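import Literature.NumberTheory.EllipticCurves.KummerSelmerStructure
import HarnessLib

/-!
# The local Kummer conditions are CARTESIAN along `E[d] ↪ E[N]` (cell `b2b-bsdres`, team n1011,
# sub-target T-a3 "Kim 2026 Thm 1.8 (6) at p = 3", step S3: Sakamoto 2024 Thm 4.4's hypothesis
# "𝓕 is cartesian" for the classical structure, any Tamagawa number, any local torsion)

HONEST FRAMING (cell `b2b-bsdres`, run/shared/lean/b2b/bsd-rank1-residual/, verbatim in every
file): the goal of the cell is to DELETE the COMBINATION-SHAPED residual classes of the
Birch–Swinnerton-Dyer formula for ALL analytic-rank `≤ 1` elliptic curves over `ℚ` — "full BSD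
formula for every rank `≤ 1` curve in class `C`" assembled STRICTLY from published theorems — so
that the rank-`≤ 1` remainder becomes exactly the CONSTRUCTION-SHAPED classes, which are TYPED
(missing-input `Prop`s), NOT attempted. This is not "finishing BSD". Team n1011 (N10/N11, the
additive block `X4 ∧ p = 3`): research route; no claim beyond the stated classes; the label X4 and
the mark of RESIDUAL-MAP §I N11 are UNCHANGED by this file; nothing is booked. Theorems only: no
definition, no named fact.

## What this file proves and why

R. Sakamoto, *The theory of Kolyvagin systems for p = 3*, JTNB 36 (2024) 919–946, Thm 4.4, asks
the Selmer structure `𝓕` to be **cartesian** (Def 3.5: for every `q ∈ S(𝓕)` the map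
`H¹(K_q, T̄)/H¹_{𝓕̄}(K_q, T̄) → H¹(K_q, T)/H¹_𝓕(K_q, T)` induced by `T̄ ↪ T` is injective — "slightly
weaker than" Mazur–Rubin's Def 1.1.4 / (H.5)–(H.6)). For the CLASSICAL (Kummer) local conditions
of an elliptic curve, `𝓛_n(E) = ker(H¹(Γ_E, E[n]) → H¹(Γ_E, E(K̄_E)))` (tree
`WeierstrassCurve.kummerLocalConditionAt`), and the change of level `ι : E[d] ↪ E[N]` (`d ∣ N`,
tree `WeierstrassCurve.torsionInclusion`), this is a tautology of functoriality: both conditions are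
kernels of maps to the SAME group `H¹(Γ_E, E(K̄_E))`, compatibly with `ι`. Hence
(`comap_kummerLocalConditionAt_torsionInclusion`) **`ι_*⁻¹(𝓛_N) = 𝓛_d`** — at EVERY place, for
EVERY Tamagawa number and EVERY local torsion `E(E)[p]` (no hypothesis at all). In skeleton
T-a3 v2 §6 (d) / the G1 answer this discharges, without Mazur–Rubin Lemma 3.7.1, the cartesian
clause at the bad primes `ℓ ≠ 3` (where Sakamoto's own §9 uses the unramified condition and
therefore needs `3 ∤ c_ℓ`, Lemma 9.3). The general degree-1 functoriality lemma
`map_one_map_one_of_comp_eq` (`H¹(g) ∘ H¹(f) = H¹(h)` when `g ∘ f = h` pointwise) is recorded on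
the way.

References: Sakamoto JTNB 36 (2024) Def 3.5, Thm 4.4, Def 9.2, Lemma 9.3 [Sakamoto2024KolyvaginThree];
Mazur–Rubin Mem. AMS 799 (2004) Def 1.1.4, §3.7 [MazurRubin2004]; Milne *ADT* I §6 [MilneADT2006].
-/

noncomputable section

open scoped Classical

universe u

namespace Summit.BirchSwinnertonDyer.Rank1Residual.Additive

open Field WeierstrassCurve
open Literature.NumberTheory.EllipticCurves Literature.NumberTheory.GaloisRepresentations
open scoped ContRepresentation

section Functoriality

variable {K : Type u} [Field K] {M N P : Type u}
  [AddCommGroup M] [TopologicalSpace M] [DiscreteTopology M]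
  [AddCommGroup N] [TopologicalSpace N] [DiscreteTopology N]
  [AddCommGroup P] [TopologicalSpace P] [DiscreteTopology P]
  {ρ : DiscreteGaloisModule K M} {ρ' : DiscreteGaloisModule K N} {ρ'' : DiscreteGaloisModule K P}

/-- **`H¹(g) ∘ H¹(f) = H¹(h)` when `g ∘ f = h` on points** (degree-1 functoriality of
`galoisCohomology.map` on classes of continuous crossed homomorphisms: both sides send `[φ]` to
`[σ ↦ g (f (φ σ))]`). Serre, *Galois Cohomology*, I §2.2. [folklore] -/
theorem map_one_map_one_of_comp_eq (f : ρ.toContRepresentation →ⁱL ρ'.toContRepresentation)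
    (g : ρ'.toContRepresentation →ⁱL ρ''.toContRepresentation)
    (h : ρ.toContRepresentation →ⁱL ρ''.toContRepresentation) (hfg : ∀ m, g (f m) = h m)
    (c : galoisCohomology ρ 1) :
    galoisCohomology.map g 1 (galoisCohomology.map f 1 c) = galoisCohomology.map h 1 c := by
  obtain ⟨φ, rfl⟩ := oneCocycleClass_surjective ρ.toTopRep c
  rw [galoisCohomology.map_one_oneCocycleClass, galoisCohomology.map_one_oneCocycleClass,
    galoisCohomology.map_one_oneCocycleClass]
  congr 1
  apply Subtype.ext
  ext σ
  exact hfg _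

end Functoriality

section Kummer

variable {K : Type u} [Field K] (W : WeierstrassCurve K) (E : Type u) [Field E] [Algebra K E]

/-- The composite `E[d] ↪ E[N] → E(K̄_E)` is the points map of `E[d]` (on points: both are
`P ↦ pointsMap P`). [folklore] -/
theorem torsionPointsMapIntertwining_torsionInclusion {d N : ℤ} (h : d ∣ N) (P : geomTorsion W d) :
    W.torsionPointsMapIntertwining N E ((W.torsionInclusion h).restrictField E P) =
      W.torsionPointsMapIntertwining d E P :=
  rfl

/-- **The Kummer local conditions are cartesian along the change of level** (Sakamoto 2024
Def 3.5 for `𝓕_cl`; Mazur–Rubin (H.6)-type): for `d ∣ N` and any `K`-field `E` (e.g. a completion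
`K_v`), a class `c ∈ H¹(Γ_E, E[d])` lies in the local Kummer condition `𝓛_d(E)` iff its image
under `ι_* : H¹(Γ_E, E[d]) → H¹(Γ_E, E[N])` lies in `𝓛_N(E)` — i.e. `ι_*⁻¹(𝓛_N) = 𝓛_d`. No
hypothesis on the place, the Tamagawa number or the local torsion. [cite: Sakamoto2024KolyvaginThree, Def. 3.5 and Thm. 4.4]
[cite: MilneADT2006, Ch. I §6 (proof of Prop. 6.9)] -/
theorem comap_kummerLocalConditionAt_torsionInclusion {d N : ℤ} (h : d ∣ N) :
    (W.kummerLocalConditionAt N E).comap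
        (galoisCohomology.map ((W.torsionInclusion h).restrictField E) 1) =
      W.kummerLocalConditionAt d E := by
  ext c
  rw [AddSubgroup.mem_comap, WeierstrassCurve.mem_kummerLocalConditionAt_iff,
    WeierstrassCurve.mem_kummerLocalConditionAt_iff,
    map_one_map_one_of_comp_eq ((W.torsionInclusion h).restrictField E)
      (W.torsionPointsMapIntertwining N E) (W.torsionPointsMapIntertwining d E)
      (torsionPointsMapIntertwining_torsionInclusion W E h) c]

/-- Pointwise form: `ι_* c ∈ 𝓛_N ↔ c ∈ 𝓛_d`. [cite: Sakamoto2024KolyvaginThree, Def. 3.5] -/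
theorem map_torsionInclusion_mem_kummerLocalConditionAt_iff {d N : ℤ} (h : d ∣ N)
    (c : galoisCohomology (GaloisRep.restrictField E (W.torsionGaloisModule d)) 1) :
    galoisCohomology.map ((W.torsionInclusion h).restrictField E) 1 c ∈ W.kummerLocalConditionAt N E ↔
      c ∈ W.kummerLocalConditionAt d E := by
  rw [← AddSubgroup.mem_comap, comap_kummerLocalConditionAt_torsionInclusion W E h]

/-- In particular `ι_*(𝓛_d) ≤ 𝓛_N` (the Kummer structure is "sub-compatible" with the change of
level — Milne *ADT* I §6, proof of Prop 6.9, "`b_{v,1}` maps to `b_v`"). [cite: MilneADT2006, Ch. I §6 (proof of Prop. 6.9)] -/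
theorem map_kummerLocalConditionAt_torsionInclusion_le {d N : ℤ} (h : d ∣ N) :
    (W.kummerLocalConditionAt d E).map
        (galoisCohomology.map ((W.torsionInclusion h).restrictField E) 1) ≤
      W.kummerLocalConditionAt N E := by
  rw [AddSubgroup.map_le_iff_le_comap, comap_kummerLocalConditionAt_torsionInclusion W E h]

end Kummer

end Summit.BirchSwinnertonDyer.Rank1Residual.Additive

end
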